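import Mathlib.LinearAlgebra.Dimension.StrongRankCondition
import Summits.MatrixMultiplication.Statement
import Summits.MatrixMultiplication.MatrixMultiplication.Theorems.AsymptoticSpectrumKronecker

/-!
# MatrixMultiplication / AsymptoticSpectrum — the flattening lower bound `n² ≤ R(⟨n,n,n⟩)`

Route `MatrixMultiplication/AsymptoticSpectrum`, item `stmt-MatrixMultiplication-0587` (rank 6):
over any field `K`, `n² ≤ R(⟨n,n,n⟩)` (Bläser 2013, §4 and §6; Bürgisser–Clausen–Shokrollahi
1997, Ch. 14, conciseness). Proof: for an optimal decomposition `⟨n,n,n⟩ = ∑_{i<r} wᵢ ⊗ uᵢ ⊗ vᵢ`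
every slice `⟨n,n,n⟩(a, ·, ·)` (`a ∈ Fin n × Fin n`) lies in the span of the `r` matrices
`uᵢ ⊗ vᵢ`, and the `n²` slices are linearly independent (slice `a` is the only one with a
non-zero entry at `((a.1, a.2), (a.2, a.2))`), so `n² ≤ r`.
-/

noncomputable section

open scoped BigOperators

namespace Literature.CplxAlg

/-- The flattening (conciseness) lower bound `n² ≤ R(⟨n,n,n⟩)` over any field
(Bläser 2013, §6; BCS 1997, Ch. 14). [cite: Blaser2013, §6] -/
theorem sq_le_tensorRank_matMulTensor (K : Type*) [Field K] (n : ℕ) :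
    n ^ 2 ≤ Literature.Computability.AlgebraicComplexity.tensorRank (Literature.Computability.AlgebraicComplexity.matMulTensor K n n n) := by
  classical
  obtain ⟨w, u, v, e⟩ :=
    exists_eq_sum_triad_tensorRank (Literature.Computability.AlgebraicComplexity.matMulTensor K n n n) (exists_eq_sum_triad _)
  set Sl : Fin n × Fin n → (Fin n × Fin n → Fin n × Fin n → K) := fun a => Literature.Computability.AlgebraicComplexity.matMulTensor K n n n a
    with hSl
  have hli : LinearIndependent K Sl := by
    rw [Fintype.linearIndependent_iff]
    intro g hg a
    have h := congr_fun (congr_fun hg (a.1, a.2)) (a.2, a.2)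
    simp only [Finset.sum_apply, Pi.smul_apply, hSl, Literature.Computability.AlgebraicComplexity.matMulTensor, smul_eq_mul, mul_ite, mul_one,
      mul_zero, Pi.zero_apply, true_and] at h
    rw [Finset.sum_ite, Finset.sum_const_zero, add_zero] at h
    rw [Finset.sum_eq_single a] at h
    · exact h
    · intro b hb hba
      exfalso; apply hba
      simp only [Finset.mem_filter, Finset.mem_univ, true_and] at hb
      exact Prod.ext hb.1 hb.2
    · intro ha; exfalso; apply ha; simp
  set B : Fin (Literature.Computability.AlgebraicComplexity.tensorRank (Literature.Computability.AlgebraicComplexity.matMulTensor K n n n)) → (Fin n × Fin n → Fin n × Fin n → K) := fun i b c => u i b * v i c with hB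
  have hspan : Set.range Sl ⊆ (Submodule.span K (Set.range B) : Set _) := by
    rintro _ ⟨a, rfl⟩
    have hx : Sl a = ∑ i, w i a • B i := by
      funext b c
      refine (congr_fun (congr_fun (congr_fun e a) b) c).trans ?_
      simp [hB, Finset.sum_apply, Literature.Computability.AlgebraicComplexity.triad, mul_assoc]
    rw [hx]
    exact Submodule.sum_mem _ fun i _ => Submodule.smul_mem _ _ (Submodule.subset_span ⟨i, rfl⟩)
  have h1 := linearIndependent_le_span' Sl hli (Set.range B) hspan
  have h2 : Fintype.card (Fin n × Fin n) ≤ Fintype.card (Set.range B) := by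
    rw [Cardinal.mk_fintype] at h1
    exact_mod_cast h1
  calc n ^ 2 = Fintype.card (Fin n × Fin n) := by simp [sq]
    _ ≤ Fintype.card (Set.range B) := h2
    _ ≤ Fintype.card (Fin (Literature.Computability.AlgebraicComplexity.tensorRank (Literature.Computability.AlgebraicComplexity.matMulTensor K n n n))) := Fintype.card_range_le B
    _ = Literature.Computability.AlgebraicComplexity.tensorRank (Literature.Computability.AlgebraicComplexity.matMulTensor K n n n) := Fintype.card_fin _


/-- Settles `stmt-MatrixMultiplication-0587`, exact signature. [cite: Blaser2013, §6] -/
theorem flattening_lower_bound :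
    ∀ (K : Type) [Field K] (n : ℕ),
      n ^ 2 ≤ Literature.Computability.AlgebraicComplexity.tensorRank (Literature.Computability.AlgebraicComplexity.matMulTensor K n n n) :=
  fun K _ n => sq_le_tensorRank_matMulTensor K n

end Literature.CplxAlg
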